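import Summits.CriticalPhenomena.PercolationContinuityZ3.Theorems.Transplant.SkelFrmBParamsBridgeF
import Summits.CriticalPhenomena.PercolationContinuityZ3.Theorems.Transplant.SkelFrmBParamsSlotsT
import HarnessLib

/-!
# N2 (frames-only node `SamePDropOfSkeletonFrm₁`, OPEN), (F) value layer — part SlotsF: **THE WIDE BRIDGE'S SIZE `KS.SF c mk := nBF + ℓBF + |hBF|`, ITS BOX
# RESIDUAL `KS.gxF c := 64·S_F` AND THE FLOORS `64·S_F ≤ M_L`, `16·S_F ≤ M_L` AT `g := gT mk gx` FOR EVERY BOX RESIDUAL `gx ≥ gxF c`** (hp-8 g42, 2026-08-23;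
# F-DISCHARGE-MAP-N2 G8/G9; N2 twin of N1 `SkelNegBParamsSlotsF` (stmt-g16) over the N2 wide pair `SkelFrmBParamsBridgeF`).
WHAT CHANGES vs N1: N1's `gxF c := max gxR2 (64·S_F)` also carried the (R) y-leg's bridge residual `gxR2` (Residuals2, RETIRED under (R-22)/K-G); here `gxF` is the face part
alone and the floor is stated HYPOTHESIS-PARAMETRICALLY in the box residual (`SF_floor_of (hgx : gxF c … ≤ gx …)`), so that stmt-g21's residual of record `gxQ`
(which must absorb `gFloorKG`, `40·K·R'0` (hg2) AND `gxF (cF κ)`) serves it by `le_max_…`; `SF_floor` is the instance `gx := gxF c`.  Uses only `ML_floorsT` (SlotsT p…: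
`gx ≤ M_L (gT mk gx)`).
NON-VACUITY (lead g11 standing order 2026-08-23T03:52:56Z): a definition and a monotonicity fact; the floor is a slot floor on `g`, listed for stmt-g21 (F-DISCHARGE-MAP-N2 'WHAT I NEED NAMED' (ii)).
builds on p205010 (kernel theorem, internal audit signed; external expert review pending) — nothing in this file uses p205010; NOTHING is claimed about the
open node `SamePDropOfSkeletonFrm₁` (`SamePDropOfSkeletonNeg₁` is CLOSED in the tree and untouched by this file).
Status sentence (coordinator 2026-08-20T04:30Z): "θ(p_c) = 0 on ℤ^d, all d ≥ 2 — kernel-verified (Lean 4/Mathlib, standard axioms); internal adversarial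
audit SIGNED 2026-08-20 04:29Z; external expert review pending."
Lane `prim-bschramm`, seat `prim-hp-8` (gen 42; (F) wrapper pen); helper file (`--supports stmt-CriticalPhenomena-4575 --as helper`); N1 text stmt-g16 (SkelNegBParamsSlotsF).
* `KS.SF`, `KS.gxF`, **`KS.SF_floor_of`**, `KS.SF_floor`.
[cite: KozmaNitzan2024, §4 Lemma 11 (pp. 22–23), Theorem 6 (pp. 25–31)] [cite: MartineauTassion2017, §4.3]
-/

noncomputable section

open scoped Classical

namespace Summit.CriticalPhenomena.PercolationContinuityZ3.Theorems.Transplant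

namespace PlanarSkeletonFrm

namespace NegB

open Literature.Probability.Percolation Literature.Probability.LatticeModels SimpleGraph
open SkelConc (Consts)
open Neg

namespace KS

/-- **The wide bridge's size** `S_F := nBF + ℓBF + |hBF|`. [this work] -/
def SF (κ : Consts) {V : Type} [DecidableEq V] [Countable V] {G : SimpleGraph V} [G.LocallyFinite] (Φ : PlanarSkeletonFrm G) (t : V) (p : unitInterval)
    (D : Skelφ.StepI.DataNS V) (c mk : ℕ) : ℕ :=
  nBF κ Φ t p D c mk + ℓBF κ Φ t p D c mk + (hBF κ Φ t p D c mk).natAbs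

/-- **The face's box residual** `gxF c := 64·S_F` (kit index `0` for the sizes, as N1). [this work] -/
def gxF (c : ℕ) : Neg.FSlot := fun κ _ _ _ _ _ Φ t p D => 64 * SF κ Φ t p D c 0

/-- **The face floors at `g := gT mk gx` for every box residual `gx ≥ gxF c`**: `64·S_F ≤ M_L` and `16·S_F ≤ M_L` (the y′-face origin's Λ-bounds). [folklore] -/
theorem SF_floor_of (κ : Consts) {V : Type} [DecidableEq V] [Countable V] {G : SimpleGraph V} [G.LocallyFinite] (Φ : PlanarSkeletonFrm G) (t : V) (p : unitInterval)
    (D : Skelφ.StepI.DataNS V) (c mk : ℕ) (gx : Neg.FSlot) (hgx : gxF c κ Φ t p D ≤ gx κ Φ t p D) :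
    64 * SF κ Φ t p D c 0 ≤ ML κ Φ t p D (gT mk gx κ Φ t p D) ∧ 16 * SF κ Φ t p D c 0 ≤ ML κ Φ t p D (gT mk gx κ Φ t p D) := by
  have h3 := (ML_floorsT κ Φ t p D mk gx).2.2.2.1
  have e : gxF c κ Φ t p D = 64 * SF κ Φ t p D c 0 := rfl
  rw [e] at hgx
  exact ⟨hgx.trans h3, by omega⟩

/-- **The face floors at the face's own residual** `g := gT mk (gxF c)`. [folklore] -/
theorem SF_floor (κ : Consts) {V : Type} [DecidableEq V] [Countable V] {G : SimpleGraph V} [G.LocallyFinite] (Φ : PlanarSkeletonFrm G) (t : V) (p : unitInterval)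
    (D : Skelφ.StepI.DataNS V) (c mk : ℕ) :
    64 * SF κ Φ t p D c 0 ≤ ML κ Φ t p D (gT mk (gxF c) κ Φ t p D) ∧ 16 * SF κ Φ t p D c 0 ≤ ML κ Φ t p D (gT mk (gxF c) κ Φ t p D) :=
  SF_floor_of κ Φ t p D c mk (gxF c) le_rfl

end KS

end NegB

end PlanarSkeletonFrm

end Summit.CriticalPhenomena.PercolationContinuityZ3.Theorems.Transplant

end
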